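import Literature.Topology.FourManifolds.HCobordismIntersectionNumberSlabProofs
import Literature.AlgebraicTopology.SingularHomology.TransverseDiscFunctional
import HarnessLib

/-!
# The normal coordinate of a right-hand disc, read on the open sublevel set below the next
# critical level

Topic `Literature/Topology/FourManifolds`.  A brick for the rigidity of natural de Rham
comparisons (`Literature.AlgebraicGeometry.HodgeTheory.NaturalDeRhamComparisonRigidity`), whose
proof detects `H_k` of the handlebody `U = {g < cutLevel n (k + 1)}` of a nice Morse function `g`
(Milnor, *Lectures on the h-cobordism theorem* (1965), Def. 4.9) by the collapse maps of the
normal coordinates of the right-hand discs `D_R(p)` of the critical points `p` of index `k`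
(Thom 1954, Ch. II; Milnor 1965, Lemmas 6.3 and 7.2: *"the intersection number of `D_R(pᵢ)` and
`D_L(p_j)` is `δᵢⱼ`"*).

For a nice Morse function `g` on a cobordism `c`, a smooth gradient-like `ξ`, `1 ≤ k ≤ n`
(`dim W = n + 1`) and a critical point `p` of index `k` (on the level `niceLevel n k`), the tree's
turned-about left-sphere setting of `p` seen from the level `b = cutLevel n (k + 1)`
(`Cobordism.IsMorseFunction.exists_leftSphereSetting_oneSub`: the setting of Def. 3.9 for
`(1 - g, -ξ)` on `c.symm`, in which `D_R(p)` is a left-hand disc) provides Milnor's normal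
coordinate to `D_R(p)` across the slab (`SlabNormalCoordinate.lean`:
`LeftSphereSetting.normalRegionW`, `normalCoordW`, the flat transverse disc `flatPoint` of the
left-hand disc `D_L(p)`).  This file reads these data on the **open** set
`U = {g < cutLevel n (k + 1)} ⊆ W` as a
`Literature.AlgebraicTopology.SingularHomology.TransverseDiscDatum` on `↥U`
(`Cobordism.HandleNormalDatum.datum`), and proves the properties consumed by the collapse
(`NormalCoordinateCollapse.lean`) and by the detection argument:

* stratum `P = D_R(p) ∩ U` (closed in `U`: it is `D_L^{1-g}(p)` cut at the open level `b`),
  neighbourhood `N`, coordinate `K = clip_r ∘ y⃗`, disc `m = ψ(0, ·)` of radius `r`;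
* `K ∘ m = id` on `B̄(0, r)` and `m(B̄(0, r)) ⊆ N` (`K_m`, `mapsTo_m`);
* the disc lies in the stable set `D_L(p)` of `p` and is a neighbourhood of `p` in it
  (`disc_subset_stable`, `disc_mem_nhdsWithin_stable`), and `D_L(p) ∩ D_R(p) = {p}`
  (`eq_centre_of_mem_stable_of_mem_P`);
* `P` misses the sublevel set `{g ≤ cutLevel n k}` and the left-hand discs of the other
  critical points of index `k` (`not_mem_P_of_apply_le`, `not_mem_P_of_mem_stableSet_of_ne`).

Everything is proved; the only definitions are the explicit sets and maps of the datum.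

## References

* J. Milnor, *Lectures on the h-cobordism theorem*, notes by L. Siebenmann and J. Sondow,
  Princeton Mathematical Notes (1965): Def. 3.1, Def. 3.9 (PDF pp. 12, 16), Def. 4.9 (PDF p. 25),
  Lemma 6.3 (PDF p. 37), Lemma 7.2 (PDF pp. 46–47). [MilnorHCobordism1965]
* R. Thom, *Quelques propriétés globales des variétés différentiables*, Comment. Math. Helv. 28
  (1954), Ch. II. [ThomCMH1954]
-/

open scoped Manifold ContDiff Topology
open Set Function Filter Metric
open Literature.AlgebraicTopology.SingularHomology

noncomputable section

namespace Literature.Topology.FourManifolds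

universe u

namespace Cobordism

variable {n : ℕ} {M N : Type u} [TopologicalSpace M] [ChartedSpace ((EuclideanSpace ℝ (Fin n))) M]
  [TopologicalSpace N] [ChartedSpace ((EuclideanSpace ℝ (Fin n))) N]

/-! ### The setting: a critical point of index `k` of a nice Morse function, seen from the next cut level -/

/-- **The data attached to a critical point `p` of index `k` of a nice Morse function**, for the
normal coordinate of its right-hand disc on `U = {g < cutLevel n (k + 1)}`: a smooth gradient-like
field `ξ` and the turned-about left-sphere setting `S` of `p` (Def. 3.9 for `(1 - g, -ξ)` on
`c.symm`, lower level `1 - cutLevel n (k + 1)`, sphere dimension `n - k`) with its chart-domain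
bound. [cite: MilnorHCobordism1965, Def. 3.9 (PDF p. 16), Def. 4.9 (PDF p. 25)] -/
structure HandleNormalDatum (c : Cobordism n M N) (g : c.W → ℝ) (k : ℕ) where
  /-- a smooth gradient-like vector field for `g` -/
  ξ : Cₛ^∞⟮𝓡∂ (n + 1); (EuclideanSpace ℝ (Fin (n + 1))), (TangentSpace (𝓡∂ (n + 1)) : c.W → Type)⟯
  /-- `ξ` is gradient-like -/
  isGradientLike : IsGradientLike (𝓡∂ (n + 1)) g ξ
  /-- the critical point -/
  p : c.W
  /-- `p` is critical of index `k` -/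
  mem : p ∈ criticalSetOfIndex (𝓡∂ (n + 1)) g k
  /-- the turned-about left-sphere setting of `p` -/
  S : Cobordism.LeftSphereSetting c.symm (fun z => 1 - g z) (⇑(-ξ)) (n - k)
  /-- its critical point is `p` -/
  q_eq : S.q = p
  /-- its lower level is `1 - cutLevel n (k + 1)` -/
  b_eq : S.b = 1 - cutLevel n (k + 1)
  /-- the Milnor chart domain lies in the open slab of the setting -/
  source_subset : S.box.chart.source ⊆ (fun z => 1 - g z) ⁻¹' Ioo S.a₀ S.a₁

/-- **Existence of the data** for a nice Morse function, a smooth gradient-like field, `1 ≤ k ≤ n`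
and a critical point of index `k` (`Cobordism.IsMorseFunction.exists_leftSphereSetting_oneSub`
with `b = cutLevel n (k + 1)`: no critical value lies in `(niceLevel n k, cutLevel n (k + 1)]`).
[cite: MilnorHCobordism1965, Def. 3.9 (PDF p. 16), Def. 4.9 (PDF p. 25)] -/
theorem IsNiceMorseFunction.exists_handleNormalDatum {c : Cobordism n M N} {g : c.W → ℝ}
    (hg : c.IsNiceMorseFunction g)
    (ξ : Cₛ^∞⟮𝓡∂ (n + 1); (EuclideanSpace ℝ (Fin (n + 1))), (TangentSpace (𝓡∂ (n + 1)) : c.W → Type)⟯)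
    (hξ : IsGradientLike (𝓡∂ (n + 1)) g ξ) {k : ℕ} (hk : k ≤ n) {p : c.W}
    (hp : p ∈ criticalSetOfIndex (𝓡∂ (n + 1)) g k) :
    ∃ D : HandleNormalDatum c g k, D.ξ = ξ ∧ D.p = p := by
  have hgM := hg.isMorseFunction
  have hpval : g p = niceLevel n k := by rw [hg.apply_eq hp.1, hp.2]
  have hkn : n + 1 - (n - k + 1) = k := by omega
  have hp' : p ∈ criticalSetOfIndex (𝓡∂ (n + 1)) g (n + 1 - (n - k + 1)) := by rwa [hkn]
  have hpb : g p < cutLevel n (k + 1) := hpval ▸ niceLevel_lt_cutLevel_succ n k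
  have hb1 : cutLevel n (k + 1) < 1 :=
    (cutLevel_strictMono n (show k + 1 < n + 2 by omega)).trans_eq (cutLevel_eq_one n)
  have hfree : ∀ z ∈ criticalSet (𝓡∂ (n + 1)) g, g z ∉ Ioc (g p) (cutLevel n (k + 1)) := by
    intro z hz hzI
    rw [hpval] at hzI
    have hzv : g z = niceLevel n (morseIndex (𝓡∂ (n + 1)) g z) := hg.apply_eq hz
    rw [hzv] at hzI
    have h1 : k < morseIndex (𝓡∂ (n + 1)) g z := (niceLevel_strictMono n).lt_iff_lt.1 hzI.1
    have h2 : niceLevel n (morseIndex (𝓡∂ (n + 1)) g z) < niceLevel n (k + 1) :=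
      hzI.2.trans_lt (cutLevel_lt_niceLevel n (k + 1))
    have h3 : morseIndex (𝓡∂ (n + 1)) g z < k + 1 := (niceLevel_strictMono n).lt_iff_lt.1 h2
    omega
  obtain ⟨S, hSq, hSb, hD⟩ := hgM.exists_leftSphereSetting_oneSub ξ hξ hp' (by omega) hpb hb1 hfree
  exact ⟨⟨ξ, hξ, p, hp, S, hSq, hSb, hD⟩, rfl, rfl⟩

namespace HandleNormalDatum

variable {c : Cobordism n M N} {g : c.W → ℝ} {k : ℕ} (D : HandleNormalDatum c g k)

/-! ### Elementary facts -/

/-- The level `b = cutLevel n (k + 1)` bounding `U`. [folklore] -/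
abbrev b : ℝ := cutLevel n (k + 1)

/-- The open sublevel set `U = {g < b}` (the datum `D` only fixes `g` and `k`; reducible, so that
`↥D.U` unfolds to the sublevel set in unification). [cite: MilnorHCobordism1965, Def. 4.9 (PDF p. 25)] -/
abbrev U (_D : HandleNormalDatum c g k) : Set c.W := {z | g z < cutLevel n (k + 1)}

/-- Unfolding `U`. [folklore] -/
theorem mem_U_iff {z : c.W} : z ∈ D.U ↔ g z < cutLevel n (k + 1) := Iff.rfl

include D in
/-- `g` is smooth. [folklore] -/
theorem contMDiff_g : ContMDiff (𝓡∂ (n + 1)) 𝓘(ℝ, ℝ) ∞ g := by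
  have h := D.S.contMDiff_f
  have : (fun z => 1 - (1 - g z)) = g := by funext z; ring
  rw [← this]
  exact contMDiff_const.sub h

include D in
/-- `g` is continuous. [folklore] -/
theorem continuous_g : Continuous g := D.contMDiff_g.continuous

include D in
/-- `g` is differentiable. [folklore] -/
theorem mdifferentiable_g : MDifferentiable (𝓡∂ (n + 1)) 𝓘(ℝ, ℝ) g :=
  D.contMDiff_g.mdifferentiable (by simp)

/-- `U` is open. [folklore] -/
theorem isOpen_U : IsOpen D.U := isOpen_lt D.continuous_g continuous_const

/-- The field of the setting is `-ξ`. [folklore] -/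
theorem coe_neg : (⇑(-D.ξ) : Π x : c.W, TangentSpace (𝓡∂ (n + 1)) x) = -⇑D.ξ :=
  ContMDiffSection.coe_neg D.ξ

/-- The stable set of the setting is the unstable set `D_R(p)` of `ξ` at `p`. [cite: MilnorHCobordism1965, proof of Thm. 9.1 (turning about)] -/
theorem stableSet_setting : stableSet (𝓡∂ (n + 1)) (⇑(-D.ξ)) D.S.q = unstableSet (𝓡∂ (n + 1)) (⇑D.ξ) D.p := by
  rw [D.q_eq, D.coe_neg, stableSet_neg]

/-- The unstable set of the setting is the stable set `D_L(p)` of `ξ` at `p`. [cite: MilnorHCobordism1965, proof of Thm. 9.1 (turning about)] -/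
theorem unstableSet_setting : unstableSet (𝓡∂ (n + 1)) (⇑(-D.ξ)) D.S.q = stableSet (𝓡∂ (n + 1)) (⇑D.ξ) D.p := by
  rw [D.q_eq, D.coe_neg, unstableSet_neg]

/-- `p` is a critical point. [folklore] -/
theorem isMCriticalPt_p : IsMCriticalPt (𝓡∂ (n + 1)) g D.p := D.mem.1

/-- `g p < b`: the level of the setting lies above `p` (`1 - b = S.b < S.b' < 1 - g p`). [folklore] -/
theorem apply_p_lt_b : g D.p < cutLevel n (k + 1) := by
  have h := D.S.b_lt_b'.trans D.S.b'_lt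
  rw [D.b_eq, D.q_eq] at h
  linarith

/-- On the unstable set of `p`, `g p ≤ g`. [cite: MilnorHCobordism1965, Def. 3.1, Def. 3.9] -/
theorem apply_p_le_of_mem_unstableSet {z : c.W} (hz : z ∈ unstableSet (𝓡∂ (n + 1)) (⇑D.ξ) D.p) :
    g D.p ≤ g z :=
  D.isGradientLike.apply_le_of_mem_unstableSet D.mdifferentiable_g hz

/-- On the stable set of `p`, `g ≤ g p`. [cite: MilnorHCobordism1965, Def. 3.1, Def. 3.9] -/
theorem apply_le_apply_p_of_mem_stableSet {z : c.W} (hz : z ∈ stableSet (𝓡∂ (n + 1)) (⇑D.ξ) D.p) :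
    g z ≤ g D.p :=
  D.isGradientLike.apply_le_of_mem_stableSet D.mdifferentiable_g hz

/-- `0 < g p`: the critical values lie in `(0, 1)`. [cite: MilnorHCobordism1965, Def. 3.1 (PDF p. 11)] -/
theorem apply_p_pos : 0 < g D.p := by
  have h := D.S.apply_le
  have h1 := D.S.pre.lt_one
  rw [D.q_eq] at h
  have h' : 1 - g D.p ≤ D.S.a₁ := h
  linarith

/-! ### The datum on `U` -/

omit [TopologicalSpace M] [ChartedSpace ((EuclideanSpace ℝ (Fin n))) M] [TopologicalSpace N] [ChartedSpace ((EuclideanSpace ℝ (Fin n))) N] in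
/-- The sphere-dimension arithmetic of the setting: `(n - k) + 1 + k = n + 1` when `k ≤ n`. [folklore] -/
theorem dim_eq (hk : k ≤ n) : n - k + 1 + k = n + 1 := by omega

/-- `1 - g p < 1` (the top `t₁ = 1` of the slab on which the flat disc is read). [folklore] -/
theorem apply_q_lt_one : (fun z => 1 - g z) D.S.q < 1 := by
  show 1 - g D.S.q < 1
  rw [D.q_eq]
  linarith [D.apply_p_pos]

/-- The stratum: the unstable set `D_R(p)` of `p`, read in `U`. [cite: MilnorHCobordism1965, Def. 3.9 (PDF p. 16)] -/
def PSet : Set ↥D.U := {u | (u : c.W) ∈ unstableSet (𝓡∂ (n + 1)) (⇑D.ξ) D.p}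

/-- Unfolding `PSet`. [folklore] -/
theorem mem_PSet_iff {u : ↥D.U} : u ∈ D.PSet ↔ (u : c.W) ∈ unstableSet (𝓡∂ (n + 1)) (⇑D.ξ) D.p := Iff.rfl

/-- The neighbourhood: Milnor's region `N` read in the open slab `{1 - b < 1 - g < 1}`. [cite: MilnorHCobordism1965, proof of Lemma 7.2 (PDF p. 47)] -/
def NSet : Set ↥D.U := {u | (u : c.W) ∈ D.S.normalRegionW ∧ D.S.b < 1 - g u ∧ 1 - g (u : c.W) < 1}

/-- On `U`, `S.b < 1 - g`. [folklore] -/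
theorem b_lt_one_sub (u : ↥D.U) : D.S.b < 1 - g u := by
  rw [D.b_eq]
  have hu : g u < cutLevel n (k + 1) := u.2
  linarith

/-- **The stratum is closed in `U`**: on `U`, the unstable set of `p` is the (closed) left-hand
disc of the setting down to its level. [cite: MilnorHCobordism1965, Def. 3.9 (PDF p. 16)] -/
theorem isClosed_PSet : IsClosed D.PSet := by
  have h : D.PSet = Subtype.val ⁻¹' leftHandDisc (𝓡∂ (n + 1)) (fun z => 1 - g z) (⇑(-D.ξ)) D.S.q D.S.b := by
    ext u
    rw [mem_PSet_iff, mem_preimage, mem_leftHandDisc_iff, D.stableSet_setting]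
    exact ⟨fun hu => ⟨hu, (D.b_lt_one_sub u).le⟩, fun hu => hu.1⟩
  rw [h]
  exact D.S.isClosed_leftHandDisc.preimage continuous_subtype_val

/-- **The neighbourhood is open in `U`** (`N` is open in the slab, and we read it on the open
slab). [folklore] -/
theorem isOpen_NSet : IsOpen D.NSet := by
  have hgc := D.continuous_g
  obtain ⟨O, hO, hOeq⟩ := isOpen_induced_iff.1 (D.S.isOpen_normalRegion (t₁ := 1))
  have h : D.NSet = Subtype.val ⁻¹' (O ∩ (fun z => 1 - g z) ⁻¹' Ioo D.S.b 1) := by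
    ext u
    simp only [NSet, mem_setOf_eq]
    constructor
    · rintro ⟨hN, hb, h1⟩
      refine ⟨?_, hb, h1⟩
      have hslab : (fun z => 1 - g z) (u : c.W) ∈ Icc D.S.b 1 := ⟨hb.le, h1.le⟩
      have hmem : (⟨(u : c.W), hslab⟩ : D.S.slab 1) ∈ D.S.normalRegion 1 := hN
      rw [← hOeq] at hmem
      exact hmem
    · rintro ⟨hO', hb, h1⟩
      refine ⟨?_, hb, h1⟩
      have hslab : (fun z => 1 - g z) (u : c.W) ∈ Icc D.S.b 1 := ⟨hb.le, h1.le⟩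
      have hmem : (⟨(u : c.W), hslab⟩ : D.S.slab 1) ∈ (Subtype.val ⁻¹' O : Set (D.S.slab 1)) := hO'
      rw [hOeq] at hmem
      exact hmem
  rw [h]
  exact (hO.inter (isOpen_Ioo.preimage (continuous_const.sub hgc))).preimage continuous_subtype_val

/-- `P ⊆ N`. [cite: MilnorHCobordism1965, Def. 3.9 (PDF p. 16)] -/
theorem PSet_subset_NSet : D.PSet ⊆ D.NSet := by
  intro u hu
  have hu' : (u : c.W) ∈ stableSet (𝓡∂ (n + 1)) (⇑(-D.ξ)) D.S.q := by rw [D.stableSet_setting]; exact hu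
  have hb := D.b_lt_one_sub u
  refine ⟨D.S.mem_normalRegionW_of_mem_stableSet hu' hb.le, hb, ?_⟩
  have := D.apply_p_le_of_mem_unstableSet hu
  linarith [D.apply_p_pos]

/-- The flat points lie in the stable set `D_L(p)` of `p`. [cite: MilnorHCobordism1965, Def. 3.1 (2), Def. 3.9 (PDF pp. 12, 16)] -/
theorem flatPoint_mem_stableSet (hk : k ≤ n) (y : (EuclideanSpace ℝ (Fin k))) :
    (D.S.flatPoint 1 (dim_eq hk) D.apply_q_lt_one y).1 ∈ stableSet (𝓡∂ (n + 1)) (⇑D.ξ) D.p := by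
  rw [← D.unstableSet_setting]
  exact D.S.flatPoint_mem_unstableSet D.source_subset (dim_eq hk) D.apply_q_lt_one y

/-- The flat points lie in `U`. [folklore] -/
theorem flatPoint_mem_U (hk : k ≤ n) (y : (EuclideanSpace ℝ (Fin k))) : (D.S.flatPoint 1 (dim_eq hk) D.apply_q_lt_one y).1 ∈ D.U :=
  (D.apply_le_apply_p_of_mem_stableSet (D.flatPoint_mem_stableSet hk y)).trans_lt D.apply_p_lt_b

/-- **The transverse flat disc**, read in `U`. [cite: MilnorHCobordism1965, Def. 3.1 (2) (PDF p. 12)] -/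
def mFun (hk : k ≤ n) (y : (EuclideanSpace ℝ (Fin k))) : ↥D.U :=
  ⟨(D.S.flatPoint 1 (dim_eq hk) D.apply_q_lt_one y).1, D.flatPoint_mem_U hk y⟩

/-- The points of `mFun`, in `W`. [folklore] -/
theorem coe_mFun (hk : k ≤ n) (y : (EuclideanSpace ℝ (Fin k))) :
    (D.mFun hk y : c.W) = (D.S.flatPoint 1 (dim_eq hk) D.apply_q_lt_one y).1 := rfl

/-- `mFun` is continuous. [folklore] -/
theorem continuous_mFun (hk : k ≤ n) : Continuous (D.mFun hk) :=
  (continuous_subtype_val.comp (D.S.continuous_flatPoint (dim_eq hk) D.apply_q_lt_one)).subtype_mk _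

/-- `mFun` is injective on `B̄(0, r)`. [folklore] -/
theorem injOn_mFun (hk : k ≤ n) : InjOn (D.mFun hk) (closedBall 0 (D.S.flatRadius 1)) := by
  intro y₁ hy₁ y₂ hy₂ h
  have h' : (D.S.flatPoint 1 (dim_eq hk) D.apply_q_lt_one y₁).1 =
      (D.S.flatPoint 1 (dim_eq hk) D.apply_q_lt_one y₂).1 := congrArg (fun u : ↥D.U => (u : c.W)) h
  exact D.S.injOn_flatPoint (dim_eq hk) D.apply_q_lt_one hy₁ hy₂ (Subtype.ext h')

/-- **The normal coordinate `clip_r ∘ y⃗`** on `N`. [cite: MilnorHCobordism1965, proof of Lemma 7.2 (PDF p. 47)] -/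
def KFun : C(↥D.NSet, (EuclideanSpace ℝ (Fin k))) :=
  ⟨fun u => radialClip (D.S.flatRadius 1) (D.S.normalCoordW (l := k) (u : c.W)),
    (continuous_radialClip (D.S.flatRadius_pos D.apply_q_lt_one)).comp
      (D.S.continuousOn_normalCoordW.comp_continuous (continuous_subtype_val.comp continuous_subtype_val)
        fun u => ⟨u.2.1, u.2.2.1.le⟩)⟩

/-- Unfolding `KFun`. [folklore] -/
theorem KFun_apply (u : ↥D.NSet) :
    D.KFun u = radialClip (D.S.flatRadius 1) (D.S.normalCoordW (l := k) (u : c.W)) := rfl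

/-- **The zero set of the normal coordinate is the stratum.** [cite: MilnorHCobordism1965, Def. 3.1 (2), Def. 3.9 (PDF pp. 12, 16)] -/
theorem KFun_eq_zero_iff (hk : k ≤ n) (u : ↥D.NSet) : D.KFun u = 0 ↔ (u : ↥D.U) ∈ D.PSet := by
  rw [KFun_apply, radialClip_eq_zero_iff (D.S.flatRadius_pos D.apply_q_lt_one),
    D.S.normalCoordW_eq_zero_iff D.source_subset (dim_eq hk) u.2.1 u.2.2.1.le, mem_PSet_iff]
  show ((u : ↥D.U) : c.W) ∈ stableSet (𝓡∂ (n + 1)) (⇑(-D.ξ)) D.S.q ↔ _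
  rw [D.stableSet_setting]

/-- **The transverse disc datum of `D_R(p)` on `U`.**  Stratum: the unstable set of `p` (in `U`);
neighbourhood: Milnor's region `N` read in the open slab `{1 - b < 1 - g < 1}`; coordinate:
`clip_r ∘ y⃗`; disc: the flat disc `ψ(0, ·)` of `D_L(p)`, radius `r`.
[cite: MilnorHCobordism1965, proof of Lemma 7.2 (PDF p. 47), Def. 3.1 (2), Def. 3.9 (PDF pp. 12, 16)] -/
def datum (hk : k ≤ n) : TransverseDiscDatum ↥D.U k where
  P := D.PSet
  N := D.NSet
  isClosed_P := D.isClosed_PSet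
  isOpen_N := D.isOpen_NSet
  subset := D.PSet_subset_NSet
  m := D.mFun hk
  r := D.S.flatRadius 1
  r_pos := D.S.flatRadius_pos D.apply_q_lt_one
  continuousOn_m := (D.continuous_mFun hk).continuousOn
  injOn_m := D.injOn_mFun hk
  K := D.KFun
  norm_le := fun _ => norm_radialClip_le (D.S.flatRadius_pos D.apply_q_lt_one) _
  eq_zero_iff := D.KFun_eq_zero_iff hk

section Datum

variable (hk : k ≤ n)

/-- The stratum of the datum is `D_R(p) ∩ U`. [folklore] -/
@[simp] theorem datum_P : (D.datum hk).P = D.PSet := rfl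

/-- The neighbourhood of the datum. [folklore] -/
@[simp] theorem datum_N : (D.datum hk).N = D.NSet := rfl

/-- The disc map of the datum. [folklore] -/
@[simp] theorem datum_m : (D.datum hk).m = D.mFun hk := rfl

/-- The points of the disc of the datum, in `W`. [folklore] -/
theorem coe_datum_m (y : (EuclideanSpace ℝ (Fin k))) :
    (((D.datum hk).m y : ↥D.U) : c.W) = (D.S.flatPoint 1 (dim_eq hk) D.apply_q_lt_one y).1 := rfl

/-- The radius of the datum is the flat radius. [folklore] -/
@[simp] theorem datum_r : (D.datum hk).r = D.S.flatRadius 1 := rfl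

/-- **The centre of the datum is `p`.** [folklore] -/
theorem coe_datum_m_zero : (((D.datum hk).m 0 : ↥D.U) : c.W) = D.p := by
  rw [coe_datum_m, D.S.coe_flatPoint_zero, D.q_eq]

/-- `p ∈ U`. [folklore] -/
theorem p_mem_U : D.p ∈ D.U := D.apply_p_lt_b

/-- The centre of the datum, as the point `p` of `U`. [folklore] -/
theorem datum_m_zero : (D.datum hk).m 0 = ⟨D.p, D.p_mem_U⟩ := Subtype.ext (D.coe_datum_m_zero hk)

/-- **The disc lies in `N`.** [folklore] -/
theorem mapsTo_m : MapsTo (D.datum hk).m (closedBall 0 (D.datum hk).r) (D.datum hk).N := by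
  intro y _
  have h1 := D.S.flatPoint_mem_normalRegion (dim_eq hk) D.apply_q_lt_one y
  refine ⟨h1, D.b_lt_one_sub _, ?_⟩
  -- `1 - g < 1` on the flat disc: the chart domain lies in `{1 - g < a₁}`, `a₁ < 1`
  have hr := D.S.flatRadius_pos D.apply_q_lt_one
  have hyc : ‖radialClip (D.S.flatRadius 1) y‖ ≤ D.S.ε :=
    (norm_radialClip_le hr y).trans D.S.flatRadius_le_eps
  have hsrc := (D.S.flatPointW_spec (dim_eq hk) hyc).1
  have h := (D.source_subset hsrc).2
  show 1 - g (D.S.flatPointW (radialClip (D.S.flatRadius 1) y)) < 1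
  exact lt_trans h D.S.pre.lt_one

/-- **`K ∘ m = id` on `B̄(0, r)`.** [cite: MilnorHCobordism1965, Def. 3.1 (2) (PDF p. 12)] -/
theorem K_m (y : (EuclideanSpace ℝ (Fin k))) (hy : y ∈ closedBall 0 (D.datum hk).r) :
    (D.datum hk).K ⟨(D.datum hk).m y, D.mapsTo_m hk hy⟩ = y := by
  have hy' : ‖y‖ ≤ D.S.flatRadius 1 := mem_closedBall_zero_iff.1 hy
  change radialClip (D.S.flatRadius 1) (D.S.normalCoordW (l := k)
    (D.S.flatPoint 1 (dim_eq hk) D.apply_q_lt_one y).1) = y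
  rw [D.S.normalCoordW_flatPoint (dim_eq hk) D.apply_q_lt_one hy',
    radialClip_of_norm_le (D.S.flatRadius_pos D.apply_q_lt_one) hy']

/-- The stable set `D_L(p)` read in `U` (it lies in `U` entirely, `g ≤ g p < b` on it). [cite: MilnorHCobordism1965, Def. 3.9 (PDF p. 16)] -/
def stable : Set ↥D.U := {u | (u : c.W) ∈ stableSet (𝓡∂ (n + 1)) (⇑D.ξ) D.p}

/-- Unfolding `stable`. [folklore] -/
theorem mem_stable_iff {u : ↥D.U} : u ∈ D.stable ↔ (u : c.W) ∈ stableSet (𝓡∂ (n + 1)) (⇑D.ξ) D.p := Iff.rfl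

/-- The stable set of `p` lies in `U`. [folklore] -/
theorem stableSet_subset_U : stableSet (𝓡∂ (n + 1)) (⇑D.ξ) D.p ⊆ D.U := fun _ hz =>
  (D.apply_le_apply_p_of_mem_stableSet hz).trans_lt D.apply_p_lt_b

/-- **The disc lies in `D_L(p)`.** [cite: MilnorHCobordism1965, Def. 3.9 (PDF p. 16)] -/
theorem disc_subset_stable : (D.datum hk).disc ⊆ D.stable := by
  rintro _ ⟨y, -, rfl⟩
  exact D.flatPoint_mem_stableSet hk y

/-- **`D_L(p) ∩ D_R(p) = {p}`**: a point of the stable set lying on the stratum is the centre. [cite: MilnorHCobordism1965, Def. 3.9 (PDF p. 16)] -/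
theorem eq_centre_of_mem_stable_of_mem_P {u : ↥D.U} (hus : u ∈ D.stable) (huP : u ∈ (D.datum hk).P) :
    u = (D.datum hk).m 0 := by
  apply Subtype.ext
  rw [D.coe_datum_m_zero hk, ← D.q_eq]
  have hus' : (u : c.W) ∈ unstableSet (𝓡∂ (n + 1)) (⇑(-D.ξ)) D.S.q := by rw [D.unstableSet_setting]; exact hus
  have huP' : (u : c.W) ∈ stableSet (𝓡∂ (n + 1)) (⇑(-D.ξ)) D.S.q := by rw [D.stableSet_setting]; exact huP
  refine D.S.eq_q_of_mem_stableSet_of_mem_unstableSet huP' hus' ?_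
  have hb : D.S.b ≤ 1 - g u := by
    rw [D.b_eq]; have := u.2; rw [mem_U_iff] at this; linarith
  exact D.S.lt_b.le.trans hb

/-- **The disc is a neighbourhood of `p` in `D_L(p)`** (read in `U`): the points of `D_L(p)` in the
small Milnor ball are flat points (as in `LeftSphereSetting.disc_mem_nhdsWithin`). [cite: MilnorHCobordism1965, Def. 3.1 (2), Def. 3.9 (PDF pp. 12, 16)] -/
theorem disc_mem_nhdsWithin_stable : (D.datum hk).disc ∈ 𝓝[D.stable] ((D.datum hk).m 0) := by
  have hl := dim_eq hk
  have ht₁ := D.apply_q_lt_one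
  have hD := D.source_subset
  have hr := D.S.flatRadius_pos ht₁
  -- the open set `O = {z ∈ box | ‖coord z‖ < r}` of `W`, pulled back to `U`
  set O : Set c.W := D.S.box.box ∩ {z | z ∈ D.S.box.chart.source ∧ ‖D.S.box.coord z‖ < D.S.flatRadius 1} with hO
  have hOo : IsOpen O := D.S.box.isOpen_box.inter
    (D.S.box.continuousOn_coord.isOpen_inter_preimage D.S.box.chart.open_source
      (isOpen_lt continuous_norm continuous_const))
  have hqO : (((D.datum hk).m 0 : ↥D.U) : c.W) ∈ O := by
    rw [coe_datum_m, D.S.coe_flatPoint_zero hl ht₁]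
    exact ⟨D.S.box.mem_box_self, D.S.box.mem_source, by rw [MilnorBox.coord_self, norm_zero]; exact hr⟩
  have hOX : (Subtype.val ⁻¹' O : Set ↥D.U) ∈ 𝓝 ((D.datum hk).m 0) :=
    (hOo.preimage continuous_subtype_val).mem_nhds hqO
  refine mem_nhdsWithin_iff_exists_mem_nhds_inter.2 ⟨_, hOX, ?_⟩
  rintro u ⟨⟨hub, -, hur⟩, hus⟩
  have hus' : (u : c.W) ∈ unstableSet (𝓡∂ (n + 1)) (⇑(-D.ξ)) D.S.q := by
    rw [D.unstableSet_setting]; exact hus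
  set v := upperProj (n - k + 1) k (n + 1) (D.S.box.coord (u : c.W)) with hv
  have huv := D.S.eq_flatPointW_of_mem_unstableSet hD hl hub hus'
  have hvn : ‖v‖ ≤ D.S.flatRadius 1 := by
    have h0 : sqSumLT (n - k + 1) (D.S.box.coord (u : c.W)) = 0 := by
      have h := D.S.pre.box_inter_unstableSet_eq D.S.box hD
      have hmem : (u : c.W) ∈ D.S.box.box ∩ {w | sqSumLT D.S.box.k (D.S.box.coord w) = 0} := by
        rw [← h]; exact ⟨hub, hus'⟩
      rw [← D.S.box_k]; exact hmem.2
    have hu := eq_upperEmb_of_sqSumLT_eq_zero hl h0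
    have : ‖D.S.box.coord (u : c.W)‖ = ‖v‖ := by rw [hu, LeftSphereSetting.norm_upperEmb_eq hl]
    rw [← this]; exact hur.le
  refine ⟨v, mem_closedBall_zero_iff.2 hvn, Subtype.ext ?_⟩
  rw [coe_datum_m, D.S.coe_flatPoint hl ht₁ hvn]
  exact huv.symm

/-- **The stratum misses `{g ≤ cutLevel n k}`** (`g ≥ g p = niceLevel n k > cutLevel n k` on
`D_R(p)`), for a nice `g`. [cite: MilnorHCobordism1965, Def. 4.9 (PDF p. 25)] -/
theorem not_mem_P_of_apply_le (hg : c.IsNiceMorseFunction g) {u : ↥D.U} (hu : g u ≤ cutLevel n k) :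
    u ∉ (D.datum hk).P := by
  intro huP
  have h1 := D.apply_p_le_of_mem_unstableSet huP
  have h2 : g D.p = niceLevel n k := by rw [hg.apply_eq D.mem.1, D.mem.2]
  have h3 := cutLevel_lt_niceLevel n k
  linarith

/-- **The stratum misses the stable sets of the other critical points on the level of `p`**: a
point on a trajectory from `p` to `p' ≠ p` is not critical, so `g p < g p'`. [cite: MilnorHCobordism1965, §4 (PDF pp. 21–22)] -/
theorem not_mem_P_of_mem_stableSet_of_ne {p' : c.W}
    (hlev : g p' = g D.p) (hne : p' ≠ D.p) {u : ↥D.U}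
    (hu : (u : c.W) ∈ stableSet (𝓡∂ (n + 1)) (⇑D.ξ) p') : u ∉ (D.datum hk).P := by
  intro huP
  have hv : ContMDiff (𝓡∂ (n + 1)) (𝓡∂ (n + 1)).tangent 1
      (fun y ↦ (⟨y, D.ξ y⟩ : TangentBundle (𝓡∂ (n + 1)) c.W)) :=
    D.ξ.contMDiff.of_le (WithTop.coe_le_coe.mpr le_top)
  by_cases huc : IsMCriticalPt (𝓡∂ (n + 1)) g u
  · -- a critical point on the stable set of `p'` is `p'`, on the unstable set of `p` is `p`
    have h0 : D.ξ u = 0 := D.isGradientLike.apply_eq_zero_of_isMCriticalPt huc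
    have h1 : p' = (u : c.W) := eq_of_mem_stableSet_of_apply_eq_zero hv h0 hu
    have h2 : D.p = (u : c.W) := eq_of_mem_unstableSet_of_apply_eq_zero hv h0 huP
    exact hne (h1.trans h2.symm)
  · have h := apply_lt_apply_of_mem_unstableSet_inter_stableSet D.mdifferentiable_g
      D.isGradientLike.mlineDeriv_pos ⟨huP, hu⟩ huc
    exact h.ne' hlev

end Datum

end HandleNormalDatum

end Cobordism

end Literature.Topology.FourManifolds

end
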